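import Summits.QuantumFields.BalabanUV.Beta.GAN24.ArrowOuterShiftBorders
import Summits.QuantumFields.BalabanUV.Beta.GAN24.ArrowScaling
import Summits.QuantumFields.BalabanUV.Beta.GAN24.AliasFibreBridge

/-!
# `BalabanUV.Beta.GAN24.ArrowOuterShift` — binder row G-an2-4 / (CONV-C), road P1-fibre, p1 row **P1-L10** `FibreStrip` ((I3′), the strip half of the K-slot),
# leaf-16's cut (M4) `L10-CUT-M4.md` row **F6 = THE OUTER LIPSCHITZ BOUND** of the scaled arrow operator (SKELETON-P1 A5 v0.3, p1's L10(i) made quantitative):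
# `‖F̃_N^{out,q}(p) − F̃_N^{out,q}(q)‖ ≤ cOut(D)·η·(1 + 1/|q|₂)³` for `Re p = q ∈ BZ ∖ {0}`, `|Im p| ≤ η ≤ 1`, UNIFORMLY IN `N ≥ 1`

NOT IN PRINT; OUR PROOF ATTEMPT.  HONEST FRAMING (cell contract, verbatim): «discharging `BetaPertH` makes Bałaban's UV stability UNCONDITIONAL — a real
constructive-QFT result; it is NOT the continuum limit and NOT the Clay problem.»  HONEST DEPENDENCY (verbatim): «continuum YM on T⁴ ⇐ BetaPertH ∧ nine spine
estimates (0/9 proved); BetaPertH ⇐ (D1) ∧ (D4) ∧ CAP+tail; G-an2-4 gates asym, D1 and NE2/3/4.»  [folklore] norm bookkeeping BY NAME over leaf-16's F1 currency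
(`ArrowOperator.arrowMat/arrowMat_sub/tBlock`, `ArrowNorms.norm_arrow_le/norm_colBorder_le/norm_rowBorder_le`, `ArrowScaling.outerArrow/scaledArrow_T/_wE/_wG/_wM/_wQ/
radO/sq_radO/radO_pos/arrowMat_eq_norms`), leaf-06's bridge `AliasFibreBridge` (`chiHat = chiAl`, `sflat = sbAl`, `boxS = SAl`, `boxSs = SAl·sAl`) and this seat's
parts `ArrowBlockLipschitz` (p203102) / `ArrowOuterShiftBlocks` / `ArrowOuterShiftWeights`; no cited fact, no wall binder, no `def`, no unit sequence touched (ref2 c2/c3);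
every constant DISPLAYED and symbolic in `D`.  NOT summit progress; discharges nothing of the K-slot `GAN24.CombesThomas.ConvCK 3 Lc`: F6 is ONE of the four inputs
(F3 inner anchor, F4 inner Lipschitz, F5 outer anchor, F6 outer Lipschitz) of F7 = (U1) (leaf-09-g6 `FibreDetStripOfAnchors.outer_case`, hypothesis `hLip`).

## What is proved (every `D`, every `N ≥ 1`; `q ∈ [−π,π]^D ∖ {0}` the real anchor, `p` a strip point over it: `reVec p = q`, `|Im p_μ| ≤ η`, `0 ≤ η ≤ 1`;
`X := outerArrow N q`, `Y := X p − X (ofRealVec q)`; `w_i(m) = sinWt N (kfine N q m i)`, `K = 1 + √D·π/2`)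
* §1 radii: `radO N q 0 ≤ |q|₂ ≤ √D·π`, `2 ≤ radO N q m` (m ≠ 0), hence the ratio `r₀/r_m ≤ K` for every alias (`ratio_le`);
* §2 the four scaled border-weight differences alias by alias (prefactors `(N²/r_m²)(r₀²/N³)`, `(N³/r_m³)(r₀³/N³)`, `(r₀/N^{D+1})(N/r_m)`, `N^{−(D+1)}` — every
  `N`-power cancels EXACTLY): `‖Y.wE m κ‖ ≤ 7(D+1)η(r₀/r_m)²Π(8N√w_i)(8N√w_κ)/N^{D+1}`, `‖Y.wG m‖ ≤ 7Dη(r₀/r_m)³Π(8N√w_i)/N^D`, `‖Y.wM m‖ ≤ 7Dη(r₀/r_m)Π(8N√w_i)/N^D`,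
  `‖Y.wQ m κ‖ ≤ 7(D+1)ηΠ(8N√w_i)(8N√w_κ)/N^{D+1}`;
* §3 squares `≤ 49(D+1)²η²K⁶64^{D+1}·Πw_i·(w_κ)` and the alias sums (`ArrowOuterShiftWeights.sum_prod_sinWt_le`: `Σ_m Πw ≤ 5^D`) ⇒ the two border Frobenius bounds
  `‖colBorder (negLocW Y)‖, ‖rowBorder Y.borW‖ ≤ η·√(49(D+1)³K⁶64^{D+1}5^D)` (`norm_colBorder_sub_le`, `norm_rowBorder_sub_le`);
* §4 blocks: `‖Y.T m‖ ≤ (48D² + 4D)·τ(1+τ)²`, `τ = η(1/2 + π/(2|q|₂))`, for EVERY alias (`norm_T_sub_le`: part 2 at `r = radO N q m`, `η/r_m ≤ η/2` off the zero alias and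
  `≤ (π/2)η/|q|₂` on it, monotonicity of `t(1+t)²`);
* §5 **`norm_arrowMat_sub_le`** (raw form: `(48D²+4D)τ(1+τ)² + 2η√(…)`) and **`outerLipschitz`** — EXACTLY the `hLip` hypothesis of
  `FibreDetStripOfAnchors.outer_case` with `Gout q p := arrowMat (outerArrow N q p)`, `η₁ = 1`, `ω q = (1 + 1/√(momSq q))³` and
  `cOut(D) = (48D² + 4D)(π/2)(1 + π/2)² + 2√(49(D+1)³(1 + √D·π/2)⁶64^{D+1}5^D)`.
WHY THE CUBE (note to F7): the A–μ/G–A entries `L·∂` of the normalised zero-alias block are cubic in symbols each moving by `O(η/r₀)`, `r₀ ≍ |q|`, so the honest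
modulus linear in `η` and uniform over `η ≤ 1` is `(1 + 1/|q|)³`; in F7's outer region `|q|∞ ≥ ρ₀/2` it is `≤ (1 + 2/ρ₀)³ =: Ω(ρ₀)` (`exists_radii` takes any `Ω`).
Unit `b2b-balaban-gan24-formalise-leaf-10` (G-an2-4 formalisation swarm, leaf prover 10, gen 5), 2026-08-20.  Value = one of F7's four inputs toward (I3′), NOT summit progress.
-/

noncomputable section

open Complex Finset Matrix
open scoped BigOperators Real Matrix.Norms.L2Operator
open Literature.Probability.LatticeModels (TorusSite)
open Literature.MathematicalPhysics.QuantumFieldTheory.Balaban1983to89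
open Literature.MathematicalPhysics.QuantumFieldTheory.Balaban1983to89.B4Strip (ofRealVec reVec Strip)
open Literature.MathematicalPhysics.QuantumFieldTheory.Balaban1983to89.B4ContourShift (BZ)
open Literature.MathematicalPhysics.QuantumFieldTheory.King1986 (momSq momSq_nonneg)

namespace Summit.QuantumFields.BalabanUV.Beta.GAN24.ArrowOuterShift

open ArrowOperator (Loc AIdx ArrowData arrowMat tBlock negLocW arrowMat_sub aliasArrow)
open ArrowNorms (colBorder rowBorder norm_arrow_le norm_colBorder_le norm_rowBorder_le)
open ArrowScaling (radO sq_radO radO_pos scaledArrow outerArrow scaledArrow_T scaledArrow_wE scaledArrow_wG scaledArrow_wM scaledArrow_wQ arrowMat_eq_norms)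
open AliasWeights (sinWt sinWt_pos sinWt_le_one kfine)
open AliasWeightsSum (lapR)
open AliasObjects (kAl sAl SAl sbAl SbAl chiAl dAl dbAl LAl)
open FibreArrow (chiHat sflat boxS boxSs)
open AliasFibreBridge (sflat_eq_sbAl boxS_eq_SAl chiHat_eq_chiAl boxSs_eq_SAl_mul_sAl)
open ArrowOuterShiftBlocks (norm_outerBlock_sub_le two_le_rad two_div_pi_mul_le_rad_zero)
open ArrowOuterShiftWeights (maj_nonneg norm_SAl_sub_le norm_SAl_sAl_sub_le norm_chiAl_sbAl_sub_le norm_chiAl_sub_le prod_maj_sq maj_sq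
  prod_const_mul_sinWt sum_prod_sinWt_le sum_prod_sinWt_mul_le)

variable {D : ℕ} {N : ℕ} [NeZero N]

open ArrowOuterShiftBorders (ratio_le ratio_nonneg norm_colBorder_sub_le norm_rowBorder_sub_le)

variable {q : Fin D → ℝ} {p : Fin D → ℂ} {η : ℝ}

/-! ## §4 The blocks: `‖(X' − X).T m‖ ≤ (48D² + 4D)·τ·(1 + τ)²`, `τ = η·(1/2 + π/(2|q|₂))`, uniformly over the aliases -/

/-- [folklore] `t ↦ t(1+t)²` is monotone on `[0, ∞)`. -/
theorem mul_one_add_sq_mono {t u : ℝ} (ht : 0 ≤ t) (htu : t ≤ u) : t * (1 + t) ^ 2 ≤ u * (1 + u) ^ 2 :=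
  mul_le_mul htu (pow_le_pow_left₀ (by linarith) (by linarith) 2) (sq_nonneg _) (ht.trans htu)

/-- [folklore] **BLOCK BOUND, EVERY ALIAS**: `‖(X' − X).T m‖ ≤ (48D² + 4D)·τ·(1+τ)²` with `τ = η·(1/2 + π/(2√|q|²))` (part 2 `norm_outerBlock_sub_le` at
`r = radO N q m`; `η/r_m ≤ η/2` off the zero alias, `≤ (π/2)η/|q|₂` on it). -/
theorem norm_T_sub_le (hN : 1 ≤ N) (hq : ∀ i, |q i| ≤ π) (hq0 : q ≠ 0) (hpq : reVec p = q) (him : ∀ i, |(p i).im| ≤ η)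
    (hη0 : 0 ≤ η) (hη1 : η ≤ 1) (m : TorusSite D N) :
    ‖(outerArrow N q p - outerArrow N q (ofRealVec q)).T m‖
      ≤ (48 * D ^ 2 + 4 * D) * (η * (1 / 2 + π / (2 * Real.sqrt (momSq q)))) * (1 + η * (1 / 2 + π / (2 * Real.sqrt (momSq q)))) ^ 2 := by
  have hr := radO_pos hq hq0 m
  have key := norm_outerBlock_sub_le (D := D) (N := N) (q := q) (p := p) (η := η) (r := radO N q m) hN hpq him hη0 hη1 m hr (sq_radO q m)
  have hT : (outerArrow N q p - outerArrow N q (ofRealVec q)).T m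
      = tBlock (fun κ => ((N : ℂ) / (radO N q m : ℂ)) * dAl N p m κ) (fun κ => ((N : ℂ) / (radO N q m : ℂ)) * dbAl N p m κ)
            (((N : ℂ) / (radO N q m : ℂ)) ^ 2 * LAl N p m)
        - tBlock (fun κ => ((N : ℂ) / (radO N q m : ℂ)) * dAl N (ofRealVec q) m κ) (fun κ => ((N : ℂ) / (radO N q m : ℂ)) * dbAl N (ofRealVec q) m κ)
            (((N : ℂ) / (radO N q m : ℂ)) ^ 2 * LAl N (ofRealVec q) m) := by
    rw [ArrowData.sub_T]
    unfold outerArrow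
    rw [scaledArrow_T, scaledArrow_T]
    simp only [Complex.ofReal_natCast]
  rw [hT]
  refine key.trans ?_
  have ht0 : 0 ≤ η / radO N q m := div_nonneg hη0 hr.le
  have hτ : η / radO N q m ≤ η * (1 / 2 + π / (2 * Real.sqrt (momSq q))) := by
    have hs : 0 < Real.sqrt (momSq q) := Real.sqrt_pos.2 (CapacitanceScalarBounds.momSq_pos hq0)
    by_cases hm : m = 0
    · subst hm
      have h := ArrowOuterShiftBlocks.div_rad_zero_le (D := D) (N := N) hN hq hq0 hr (sq_radO q 0) hη0
      calc η / radO N q 0 ≤ π / 2 * (η / Real.sqrt (momSq q)) := h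
        _ = η * (π / (2 * Real.sqrt (momSq q))) := by field_simp
        _ ≤ η * (1 / 2 + π / (2 * Real.sqrt (momSq q))) := mul_le_mul_of_nonneg_left (by linarith) hη0
    · have h := ArrowOuterShiftBlocks.div_rad_le_half hq hm hr (sq_radO q m) hη0
      calc η / radO N q m ≤ η / 2 := h
        _ = η * (1 / 2) := by ring
        _ ≤ η * (1 / 2 + π / (2 * Real.sqrt (momSq q))) :=
            mul_le_mul_of_nonneg_left (by linarith [show 0 ≤ π / (2 * Real.sqrt (momSq q)) by positivity]) hη0
  have hD : (0 : ℝ) ≤ 48 * D ^ 2 + 4 * D := by positivity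
  calc (48 * (D : ℝ) ^ 2 + 4 * D) * (η / radO N q m) * (1 + η / radO N q m) ^ 2
      = (48 * (D : ℝ) ^ 2 + 4 * D) * ((η / radO N q m) * (1 + η / radO N q m) ^ 2) := by ring
    _ ≤ (48 * (D : ℝ) ^ 2 + 4 * D) * ((η * (1 / 2 + π / (2 * Real.sqrt (momSq q)))) * (1 + η * (1 / 2 + π / (2 * Real.sqrt (momSq q)))) ^ 2) :=
        mul_le_mul_of_nonneg_left (mul_one_add_sq_mono ht0 hτ) hD
    _ = _ := by ring

/-! ## §5 Assembly: the outer Lipschitz bound of the scaled arrow operator -/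

/-- [folklore] **F6 RAW FORM.**  For `N ≥ 1`, `q ∈ [−π,π]^D ∖ {0}`, a strip point `p` over `q` (`reVec p = q`, `|Im p_i| ≤ η`, `0 ≤ η ≤ 1`):
`‖arrowMat (outerArrow N q p) − arrowMat (outerArrow N q (ofRealVec q))‖ ≤ (48D² + 4D)·τ(1+τ)² + 2η·√(49(D+1)³K⁶64^{D+1}5^D)`,
`τ = η(1/2 + π/(2|q|₂))`, `K = 1 + √D·π/2` (F1a `arrowMat_sub` + F1c `arrowMat_eq_norms` + F1b `norm_arrow_le`). -/
theorem norm_arrowMat_sub_le (hN : 1 ≤ N) (hq : ∀ i, |q i| ≤ π) (hq0 : q ≠ 0) (hpq : reVec p = q) (him : ∀ i, |(p i).im| ≤ η)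
    (hη0 : 0 ≤ η) (hη1 : η ≤ 1) :
    ‖arrowMat (outerArrow N q p) - arrowMat (outerArrow N q (ofRealVec q))‖
      ≤ (48 * D ^ 2 + 4 * D) * (η * (1 / 2 + π / (2 * Real.sqrt (momSq q)))) * (1 + η * (1 / 2 + π / (2 * Real.sqrt (momSq q)))) ^ 2
        + 2 * (η * Real.sqrt (49 * (D + 1) ^ 3 * (1 + Real.sqrt D * π / 2) ^ 6 * (64 : ℝ) ^ (D + 1) * (5 : ℝ) ^ D)) := by
  rw [arrowMat_sub, arrowMat_eq_norms]
  have hT0 : 0 ≤ (48 * (D : ℝ) ^ 2 + 4 * D) * (η * (1 / 2 + π / (2 * Real.sqrt (momSq q)))) * (1 + η * (1 / 2 + π / (2 * Real.sqrt (momSq q)))) ^ 2 := by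
    positivity
  refine (norm_arrow_le _ _ _ hT0 (fun m => norm_T_sub_le hN hq hq0 hpq him hη0 hη1 m)).trans ?_
  have h1 := norm_colBorder_sub_le hN hq hq0 hpq him hη0 hη1
  have h2 := norm_rowBorder_sub_le hN hq hq0 hpq him hη0 hη1
  linarith

/-- [folklore] **ROW F6 OF THE CUT — THE OUTER LIPSCHITZ BOUND, IN F7's RE/IM FORM** (`FibreDetStripOfAnchors.outer_case`, hypothesis `hLip`, with
`Gout q p := arrowMat (outerArrow N q p)`, `η₁ = 1`, modulus `ω q = (1 + 1/|q|₂)³`):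
for every `N ≥ 1`, every real `q ∈ BZ D` with `q ≠ 0`, every `p` with `reVec p = q` and `|Im p_μ| ≤ η`, `0 ≤ η ≤ 1`,
`‖arrowMat (outerArrow N q p) − arrowMat (outerArrow N q (ofRealVec q))‖ ≤ cOut(D)·η·(1 + 1/√|q|²)³` with the DISPLAYED constant
`cOut(D) = (48D² + 4D)·(π/2)·(1 + π/2)² + 2·√(49(D+1)³·(1 + √D·π/2)⁶·64^{D+1}·5^D)`. -/
theorem outerLipschitz (hN : 1 ≤ N) :
    ∀ q ∈ BZ D, q ≠ 0 → ∀ p : Fin D → ℂ, reVec p = q → ∀ η : ℝ, 0 ≤ η → η ≤ 1 → (∀ μ, |(p μ).im| ≤ η) →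
      ‖arrowMat (outerArrow N q p) - arrowMat (outerArrow N q (ofRealVec q))‖
        ≤ ((48 * D ^ 2 + 4 * D) * (π / 2) * (1 + π / 2) ^ 2
            + 2 * Real.sqrt (49 * (D + 1) ^ 3 * (1 + Real.sqrt D * π / 2) ^ 6 * (64 : ℝ) ^ (D + 1) * (5 : ℝ) ^ D))
          * η * (1 + 1 / Real.sqrt (momSq q)) ^ 3 := by
  intro q hqBZ hq0 p hpq η hη0 hη1 him
  have hq : ∀ i, |q i| ≤ π := fun i => abs_le.2 ⟨hqBZ.1 i, hqBZ.2 i⟩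
  refine (norm_arrowMat_sub_le hN hq hq0 hpq him hη0 hη1).trans ?_
  set s := Real.sqrt (momSq q) with hs
  have hs0 : 0 < s := Real.sqrt_pos.2 (CapacitanceScalarBounds.momSq_pos hq0)
  set ω := 1 + 1 / s with hω
  have hω1 : 1 ≤ ω := by rw [hω]; linarith [show (0 : ℝ) ≤ 1 / s by positivity]
  set τ := η * (1 / 2 + π / (2 * s)) with hτ
  have hπ : (1 : ℝ) / 2 ≤ π / 2 := by linarith [Real.pi_gt_three]
  -- `τ ≤ (π/2)·η·ω` and `1 + τ ≤ (1 + π/2)·ω`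
  have hτ1 : τ ≤ π / 2 * η * ω := by
    rw [hτ, hω]
    have : 1 / 2 + π / (2 * s) ≤ π / 2 * (1 + 1 / s) := by
      rw [show π / (2 * s) = π / 2 * (1 / s) by field_simp]; nlinarith [show (0:ℝ) ≤ 1 / s by positivity]
    calc η * (1 / 2 + π / (2 * s)) ≤ η * (π / 2 * (1 + 1 / s)) := mul_le_mul_of_nonneg_left this hη0
      _ = π / 2 * η * (1 + 1 / s) := by ring
  have hτ0 : 0 ≤ τ := by rw [hτ]; positivity
  have hω0 : 0 ≤ ω := by linarith
  have h1τ : 1 + τ ≤ (1 + π / 2) * ω := by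
    have hπη : π / 2 * η ≤ π / 2 := mul_le_of_le_one_right (by positivity) hη1
    have : τ ≤ π / 2 * ω := hτ1.trans (mul_le_mul_of_nonneg_right hπη hω0)
    nlinarith
  have hA : τ * (1 + τ) ^ 2 ≤ π / 2 * (1 + π / 2) ^ 2 * η * ω ^ 3 := by
    calc τ * (1 + τ) ^ 2 ≤ (π / 2 * η * ω) * ((1 + π / 2) * ω) ^ 2 :=
          mul_le_mul hτ1 (pow_le_pow_left₀ (by linarith) h1τ 2) (sq_nonneg _) (by positivity)
      _ = π / 2 * (1 + π / 2) ^ 2 * η * ω ^ 3 := by ring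
  have hB : η * Real.sqrt (49 * (D + 1) ^ 3 * (1 + Real.sqrt D * π / 2) ^ 6 * (64 : ℝ) ^ (D + 1) * (5 : ℝ) ^ D)
      ≤ Real.sqrt (49 * (D + 1) ^ 3 * (1 + Real.sqrt D * π / 2) ^ 6 * (64 : ℝ) ^ (D + 1) * (5 : ℝ) ^ D) * η * ω ^ 3 := by
    have hω3 : 1 ≤ ω ^ 3 := one_le_pow₀ hω1
    have hR := Real.sqrt_nonneg (49 * (D + 1) ^ 3 * (1 + Real.sqrt D * π / 2) ^ 6 * (64 : ℝ) ^ (D + 1) * (5 : ℝ) ^ D)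
    nlinarith [mul_nonneg hR hη0]
  have hD : (0 : ℝ) ≤ 48 * D ^ 2 + 4 * D := by positivity
  nlinarith [mul_le_mul_of_nonneg_left hA hD]

end Summit.QuantumFields.BalabanUV.Beta.GAN24.ArrowOuterShift

end
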